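import Summits.BirchSwinnertonDyer.BirchSwinnertonDyer.Theorems.KatoDescentPotSupersingularReducibleH2DescentCountStrict
import Summits.BirchSwinnertonDyer.BirchSwinnertonDyer.Theorems.KatoDescentPotSupersingularMemberHullZetaInputsOfCorePrelim
import Summits.BirchSwinnertonDyer.BirchSwinnertonDyer.Theorems.KatoDescentPotSupersingularStrictSelmerBridge
import Summits.BirchSwinnertonDyer.BirchSwinnertonDyer.Theorems.KatoDescentPotSupersingularIntegralH1LayerZeroTop
import Summits.BirchSwinnertonDyer.BirchSwinnertonDyer.Theorems.KatoDescentPotSupersingularASideIndexHypothesis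
import Summits.BirchSwinnertonDyer.BirchSwinnertonDyer.Theorems.PoitouTateSelmerStructureDualityConjHolds
import Literature.NumberTheory.EllipticCurves.HasseWeilGoodReduction
import HarnessLib

/-!
# CRUX M's INEQUALITY ON THE TAME REDUCIBLE ROWS MODULO ONE PINNED PRINT CLAUSE: for Kato's zeta lift `𝐲` and every
# exponent `e` with (b′) `ZetaLineOrthIndexAt W p 𝐲₀ e`:
# `ord_p #Ш(W)[p^∞] + v_p(Tam W) ≤ e + v_p(c_p) + 2·v_p #W(ℚ)_tors` — from the six atomic facts {H2X, Z0, 13.4, Serre, FW, Lim 3.5},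
# the KERNEL Poitou–Tate ledger (parts 39–58) and the KERNEL Thm. 14.5 (3) of `…ReducibleH2DescentCount{,Strict}` (crux M 19196)

Seat `bsd-potss-rkm` g28 (prover, cell `bsd-potss`), item stmt-BirchSwinnertonDyer-19196 `ReducibleKatoMember` = crux M of K9
`KatoDescentPotSupersingular` (support) / K8-t′ `KatoDescentTamePotSupersingular` (auto-crux); `--supports … --as helper`; route-free;
closes nothing.  HONEST FRAMING: BSD is not proved by any of this; nothing is booked; crux M stays cite-level on {modularity, HELD 27962
`Kato2004.exists_memberHullZetaCoreInputs`}; theorems only (no definition, no named fact, no `sorry`).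

## What and why

Crux M (`O6.KatoMemberShaBoundOfReducible`): at some member `W'` of the isogeny class,
`ord_p #Ш(W')[p^∞] + ord_p Tam(W') ≤ ord_p(L(W',1)/Ω(W')) + 3·ord_p #W'(ℚ)_tors`.  In the kernel it holds over {modularity, HELD 27962}
(`Theorems.reducibleKatoMember_of_newformZ_of_coreInputs`), 27962 being the `∃`-PACKAGE of Kato's inputs at his member: the reflexive hull
`F/j/z_γ/λ`, an abstract `𝐇²` with (14.14.1), Thm. 12.5 (3) off `(p)`, `μ(𝐇²) = 0`, (b′) the local index of the zeta line at `p`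
(`ZetaLineOrthIndexAt W p 𝐲₀ e`, `e = ord_p(L(W,1)/Ω) + v_p(λ(0)) + ord_p #W(ℚ_p)[p^∞] − v_p(c_p)`: Prop. 14.16 (2) `ν` / Lemma 14.18, Kim
§3.2.3, with the VALUE Thm. 12.5 (1) + Lemma 13.10 (1)) and (c2′) `#(𝐇²/X𝐇²)`.  The count of 27962 is assembled in the kernel (seat g21,
`MemberHullZetaCoreInputs.count_of_zetaLineIndex_of_katoH2Count`) from the Poitou–Tate ledger of parts 39–58
(`tamagawa_mul_sha_mul_index_le_ppart_of_zetaLineOrthIndexAt`: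
`p^{v_p(Tam W)}·#Ш(W)[p^∞]·[A : ℤ_p y₀] ≤ p^{v_p(c_p)}·#Sel_str(ℚ,W[p^∞])·p^e·(p^{v_p #W(ℚ)_tors})²`) and the package's `𝐇²`-clauses.

THIS FILE: on the rows with `W(ℚ_p)[p] = 0` the `𝐇²`-clauses are not needed.  The prequel proves there, from the six ATOMIC facts, Kato's
Thm. 14.5 (3) at level `0`: `#Sel_str(ℚ, W[p^∞]) ∣ [A : ℤ_p 𝐲₀]` for Kato's zeta lift `𝐲`; cancelling `#Sel_str` against `[A : ℤ_p 𝐲₀]` in the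
ledger (Poitou–Tate over `ℚ` being a kernel theorem, `InputsPoitouTateSelmer.poitouTate_selmerStructure_duality_conj_holds`) leaves

  **`ord_p #Ш(W)[p^∞] + v_p(Tam W) ≤ e + v_p(c_p) + 2·v_p #W(ℚ)_tors` for EVERY `e` with `ZetaLineOrthIndexAt W p 𝐲₀ e`.**

* §1 `natCard_quotient_span_layerZero_eq_relIndex_top` — the two spellings of Kato's index agree: `#(H¹(ℤ[1/p],T)_{layer 0}/ℤ_p y₀) =
  [H¹(ℤ[1/p],T)_⊤ : ℤ_p·layerZeroToTop y₀]`.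
* §2 **`padicValNat_sha_add_tamagawa_le_of_zetaLineOrthIndexAt_of_dvd`** — for ANY class `y ∈ 𝐇¹_Γ(T_pW)` with `[A : ℤ_p y₀]` finite and
  `#Sel_str ∣ [A : ℤ_p y₀]`, and any `e` with (b′): the displayed inequality (unconditional given its hypotheses; `p` odd; `W(ℚ)`, `Ш(W)[p^∞]` finite).
* §3 **`padicValNat_sha_add_tamagawa_le_of_zetaLineOrthIndexAt_zetaLift`** — ON THE LIFT of a value-guarded `ZetaBody` family (the binder under
  which 27962 speaks of `𝐲`), `W(ℚ_p)[p] = 0`, reducible non-CM rank-0 row: `∀ e, ZetaLineOrthIndexAt W p 𝐲₀ e → …`, modulo {H2X, 13.4, Serre,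
  FW, Lim 3.5}; the `∃`-form `exists_zetaLift_…` over {H2X, Z0, 13.4, Serre, FW, Lim 3.5}; rows `…_of_addv_of_eleven_le` (EVERY additive
  `p ≥ 11` = all (t′) rows of K8-t′), `…_of_addv` (`p ∈ {5,7}` off Kodaira II/III).

READING (what is left of 27962 on the tame rows of K8-t′).  With `t_p = ord_p #W(ℚ_p)[p^∞] = 0` there and `c_p ≤ 4` at an additive prime
(so `v_p(c_p) = 0` for `p ≥ 5`; not used here — the term is displayed), crux M's inequality AT `W` ITSELF follows from the displayed bound as
soon as (b′) holds for THIS `𝐲₀` with some `e ≤ ord_p(L(W,1)/Ω(W)) + ord_p #W(ℚ)_tors` — in Kato's proof `e = ord_p(L(W,1)/Ω) + v_p(λ(0))`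
with `v_p(λ(0)) ≤ ord_p #W(ℚ)_tors` for a suitable admissible `(c,d,A)` (the hull multiplier, Lemma 13.10 (1) / 13.12).  So on these rows the
distance from the six atomic facts to M is EXACTLY ONE printed clause about a PINNED object (the local orthogonal index at `p` of the
bottom class of Kato's `(c,d)`-zeta lift = the VALUE of `exp*` on it, Thm. 12.5 (1) + Lemma 14.18 / Kim §3.2.3), no `∃`-package, no abstract
`𝐇²`, no hull.

References: K. Kato, Astérisque 295 (2004), Thm. 12.5 (1) (p. 221), Lemma 13.10 (1) (p. 230), Thm. 14.5 (p. 236), (14.9.3) (p. 240), §14.14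
(pp. 243–244), Prop. 14.16 (2) and its proof (pp. 244–245), Lemma 14.18 (pp. 247–248) [Kato2004Asterisque]; C.-H. Kim, AJM 148 §3.2.3
[Kim2022StructureSelmer]; J. S. Milne, *ADT* I Cor. 2.3, Thm. 4.10 (b) [MilneADT2006]; J. H. Silverman, *AEC* VII.6.1 (`c_p ≤ 4`) [SilvermanAEC2009].
-/

-- the summit and its single problem are both named `BirchSwinnertonDyer` (registry layout D-0017)
set_option linter.dupNamespace false
set_option autoImplicit false

noncomputable section

open scoped Classical ContRepresentation NumberField TensorProduct
open CategoryTheory Function Field NumberField IsDedekindDomain WeierstrassCurve CongruenceSubgroup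
open Literature.NumberTheory.EllipticCurves Literature.NumberTheory.GaloisRepresentations
  Literature.NumberTheory.GaloisRepresentations.DiscreteGaloisModule Literature.NumberTheory.GaloisCohomology
open Literature.NumberTheory.EllipticCurves.ModularForms
open Literature.NumberTheory.EllipticCurves.Kato2004 Literature.NumberTheory.EllipticCurves.Kato2004.EulerSystemValues
open Literature.NumberTheory.EllipticCurves.IwasawaAlgebra Literature.NumberTheory.EllipticCurves.IwasawaDual
open Literature.NumberTheory.EllipticCurves.Rank1Residual
open Summit.BirchSwinnertonDyer.Rank1Residual
open Summit.BirchSwinnertonDyer.Rank1Residual.X11b.Levels Summit.BirchSwinnertonDyer.Rank1Residual.X11b.LocBridge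
  Summit.BirchSwinnertonDyer.Rank1Residual.X11b.AcSelmer
open Summit.BirchSwinnertonDyer.BirchSwinnertonDyer.Theorems
open Summit.BirchSwinnertonDyer.BirchSwinnertonDyer.Theorems.ASideJunction
open Summit.BirchSwinnertonDyer.BirchSwinnertonDyer.Theorems.KatoFiniteLevelCount
open Summit.BirchSwinnertonDyer.BirchSwinnertonDyer.Theorems.StrictSelmerBridge
open Summit.BirchSwinnertonDyer.BirchSwinnertonDyer.Theorems.IntegralH1LayerZeroTop

namespace Summit.BirchSwinnertonDyer.BirchSwinnertonDyer.Theorems.ReducibleTameShaBound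

/-! ## §1 The two spellings of Kato's index `[H¹(ℤ[1/p],T_pW) : ℤ_p y₀]` -/

section Index

variable {W : WeierstrassCurve ℚ} [W.IsElliptic] {p : ℕ} [Fact p.Prime]
  [ContinuousSMul ℤ_[p] (W.tateModule p)] {κ : ZpExtension ℚ p} {γ : absoluteGaloisGroup ℚ}

/-- **`#(H¹(ℤ[1/p],T_pW)_{layer 0} ⧸ ℤ_p·y₀) = [H¹(ℤ[1/p],T_pW)_⊤ : ℤ_p·layerZeroToTop y₀]`** (`y₀ = proj₀ y`): the index of the
descent files (`integralH1 … (κ.layerSubgroup 0)`) equals the relative index of the Poitou–Tate ledger (`integralH1 … ⊤`), transported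
along `exists_integralH1LayerZeroEquivTop` (as in `IwasawaH2Data.natCard_quotient_eq_relIndex_top`, without a package).
[cite: Kato2004Asterisque, §8.2 (p. 180), Thm. 14.5 (2) (p. 236) and §14.14 (14.14.1) (p. 243)] -/
theorem natCard_quotient_span_layerZero_eq_relIndex_top (I : IwasawaH1Data W p κ γ) (y : I.H) :
    Nat.card (integralH1 (tateRep W p) p (κ.layerSubgroup 0) ⧸
        Submodule.span ℤ_[p] {(⟨I.proj 0 y, I.proj_mem 0 y⟩ : integralH1 (tateRep W p) p (κ.layerSubgroup 0))}) =
      (ℤ_[p] ∙ layerZeroToTop W p κ (I.proj 0 y)).toAddSubgroup.relIndex (integralH1 (tateRep W p) p ⊤).toAddSubgroup := by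
  set y₀ : integralH1 (tateRep W p) p (κ.layerSubgroup 0) := ⟨I.proj 0 y, I.proj_mem 0 y⟩ with hy₀
  obtain ⟨ψ, hψ⟩ := exists_integralH1LayerZeroEquivTop W p κ
  have hmap : ((ℤ_[p]) ∙ y₀).toAddSubgroup.map (ψ : integralH1 (tateRep W p) p (κ.layerSubgroup 0) →+ _) =
      ((ℤ_[p]) ∙ ψ y₀).toAddSubgroup := by
    ext x
    simp only [AddSubgroup.mem_map, Submodule.mem_toAddSubgroup, Submodule.mem_span_singleton, AddMonoidHom.coe_coe]
    constructor
    · rintro ⟨z, ⟨a, rfl⟩, rfl⟩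
      exact ⟨a, by rw [map_smul]⟩
    · rintro ⟨a, rfl⟩
      exact ⟨a • y₀, ⟨a, rfl⟩, by rw [map_smul]⟩
  have eq2 : (integralH1 (tateRep W p) p (κ.layerSubgroup 0) ⧸ (ℤ_[p]) ∙ y₀) ≃+
      (integralH1 (tateRep W p) p ⊤ ⧸ (ℤ_[p]) ∙ ψ y₀) :=
    QuotientAddGroup.congr ((ℤ_[p]) ∙ y₀).toAddSubgroup ((ℤ_[p]) ∙ ψ y₀).toAddSubgroup ψ.toAddEquiv hmap
  have hψy : ψ y₀ = ⟨layerZeroToTop W p κ (I.proj 0 y), layerZeroToTop_mem_integralH1 W p κ (I.proj_mem 0 y)⟩ :=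
    Subtype.ext (hψ y₀)
  rw [Nat.card_congr eq2.toEquiv, hψy]
  exact natCard_quotient_span_eq_relIndex _ _ _

end Index

/-! ## §2 The bound from (b′) and `#Sel_str ∣ [A : ℤ_p y₀]`, for any class -/

section Bound

variable (W : WeierstrassCurve ℚ) [W.IsElliptic] (p : ℕ) [Fact p.Prime]
  [ContinuousSMul ℤ_[p] (W.tateModule p)] [Finite W.toAffine.Point] [Finite (AddCommGroup.primaryComponent W.sha p)]
  {κ : ZpExtension ℚ p} {γ : absoluteGaloisGroup ℚ}

/-- **`ord_p #Ш(W)[p^∞] + v_p(Tam W) ≤ e + v_p(c_p) + 2·v_p #W(ℚ)_tors`** for every class `y ∈ 𝐇¹_Γ(T_pW)` whose bottom class has FINITE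
index `[H¹(ℤ[1/p],T_pW) : ℤ_p y₀]` DIVISIBLE BY `#Sel_str(ℚ, W[p^∞])` (`katoStrictSelmer W p {v_p}`; Kato Thm. 14.5 (3) at level `0` — on
the tame reducible rows the prequel's kernel theorem), and every `e` with (b′) `ZetaLineOrthIndexAt W p (layerZeroToTop y₀) e` (`p ≠ 2`;
`W(ℚ)`, `Ш(W)[p^∞]` finite).  PROOF: the Poitou–Tate ledger `p^{v_p Tam}·#Ш[p^∞]·[A : ℤ_p y₀] ≤ p^{v_p c_p}·#Sel_str·p^e·(p^{v_p #tors})²`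
(`tamagawa_mul_sha_mul_index_le_ppart_of_zetaLineOrthIndexAt`, parts 39–58, with Poitou–Tate over `ℚ` a kernel theorem) and
`[A : ℤ_p y₀] = #Sel_str · t`, `t ≥ 1`.  No package, no `𝐇²`, no named fact in the binders.
[cite: Kato2004Asterisque, Thm. 14.5 (3) (p. 236), (14.9.3) (p. 240), Prop. 14.16 (2) and its proof (pp. 244–245), Lemma 14.18 (pp. 247–248)]
[cite: MilneADT2006, Ch. I, Cor. 2.3, Thm. 4.10 (b)] -/
theorem padicValNat_sha_add_tamagawa_le_of_zetaLineOrthIndexAt_of_dvd (hodd : p ≠ 2)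
    (I : IwasawaH1Data W p κ γ) (y : I.H)
    (hfin : Finite (integralH1 (tateRep W p) p (κ.layerSubgroup 0) ⧸
      Submodule.span ℤ_[p] {(⟨I.proj 0 y, I.proj_mem 0 y⟩ : integralH1 (tateRep W p) p (κ.layerSubgroup 0))}))
    (hdvd : Nat.card (katoStrictSelmer W p {primePlace p}) ∣
      Nat.card (integralH1 (tateRep W p) p (κ.layerSubgroup 0) ⧸
        Submodule.span ℤ_[p] {(⟨I.proj 0 y, I.proj_mem 0 y⟩ : integralH1 (tateRep W p) p (κ.layerSubgroup 0))}))
    (e : ℕ) (hb : ZetaLineOrthIndexAt W p (layerZeroToTop W p κ (I.proj 0 y)) e) :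
    padicValNat p (Nat.card (AddCommGroup.primaryComponent W.sha p)) + padicValNat p W.tamagawaProduct ≤
      e + padicValNat p ((W.baseChange ((primePlace p).adicCompletion ℚ)).localTamagawaNumber
          ((primePlace p).adicCompletionIntegers ℚ)) + 2 * padicValNat p W.torsionOrder := by
  have hp : p.Prime := Fact.out
  have hPT : poitouTate_selmerStructure_duality ℚ :=
    poitouTate_selmerStructure_duality_of_conj (InputsPoitouTateSelmer.poitouTate_selmerStructure_duality_conj_holds ℚ)
  -- the zeta line at `⊤` and the index in the ledger currency
  set y₀ : H1 (tateRep W p) ⊤ := layerZeroToTop W p κ (I.proj 0 y) with hy₀def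
  have hy₀ : y₀ ∈ integralH1 (tateRep W p) p ⊤ := layerZeroToTop_mem_integralH1 W p κ (I.proj_mem 0 y)
  have hrel := natCard_quotient_span_layerZero_eq_relIndex_top I y
  have hidx0 : Nat.card (integralH1 (tateRep W p) p (κ.layerSubgroup 0) ⧸
      Submodule.span ℤ_[p] {(⟨I.proj 0 y, I.proj_mem 0 y⟩ : integralH1 (tateRep W p) p (κ.layerSubgroup 0))}) ≠ 0 :=
    Nat.card_pos.ne'
  have hrel0 : (ℤ_[p] ∙ y₀).toAddSubgroup.relIndex (integralH1 (tateRep W p) p ⊤).toAddSubgroup ≠ 0 := hrel ▸ hidx0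
  obtain ⟨N, hN⟩ := exists_pow_smul_mem_span_singleton_of_relIndex_ne_zero (integralH1 (tateRep W p) p ⊤) y₀ hy₀ hrel0
  -- the strict-unramified and relaxed-unramified structures, the finite set of bad places
  obtain ⟨𝓢inf, hSp, hSur, hSinl⟩ : ∃ 𝓢 : SelmerStructure (primaryGaloisModule W p),
      𝓢 (Sum.inr (primePlace p)) = ⊥ ∧
      (∀ v : HeightOneSpectrum (𝓞 ℚ), v ≠ primePlace p →
        𝓢 (Sum.inr v) = unramifiedSubgroup (GaloisRep.toLocal v (primaryGaloisModule W p)) 1) ∧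
      ∀ w : InfinitePlace ℚ, 𝓢 (Sum.inl w) = ⊤ :=
    ⟨fun v => match v with
      | Sum.inl _ => ⊤
      | Sum.inr v => if v = primePlace p then ⊥ else unramifiedSubgroup (GaloisRep.toLocal v (primaryGaloisModule W p)) 1,
     if_pos rfl, fun v hv => if_neg hv, fun _ => rfl⟩
  obtain ⟨𝓤inf, hUp, hUur, hUinl⟩ : ∃ 𝓤 : SelmerStructure (primaryGaloisModule W p),
      𝓤 (Sum.inr (primePlace p)) = ⊤ ∧
      (∀ v : HeightOneSpectrum (𝓞 ℚ), v ≠ primePlace p →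
        𝓤 (Sum.inr v) = unramifiedSubgroup (GaloisRep.toLocal v (primaryGaloisModule W p)) 1) ∧
      ∀ w : InfinitePlace ℚ, 𝓤 (Sum.inl w) = ⊤ :=
    ⟨fun v => match v with
      | Sum.inl _ => ⊤
      | Sum.inr v => if v = primePlace p then ⊤ else unramifiedSubgroup (GaloisRep.toLocal v (primaryGaloisModule W p)) 1,
     if_pos rfl, fun v hv => if_neg hv, fun _ => rfl⟩
  obtain ⟨S, hS⟩ : ∃ S : Finset (HeightOneSpectrum (𝓞 ℚ)), ∀ v, v ∉ S → W.HasGoodReductionAt v := by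
    have h := WeierstrassCurve.eventually_hasGoodReductionAt W
    rw [Filter.eventually_cofinite] at h
    exact ⟨h.toFinset, fun v hv => by_contra fun hbad => hv (h.mem_toFinset.mpr hbad)⟩
  -- part 58: the level-0 count in naturals; part 59: the strict group in the Literature currency
  have h58 := tamagawa_mul_sha_mul_index_le_ppart_of_zetaLineOrthIndexAt W p 𝓤inf 𝓢inf hPT hodd (insert (primePlace p) S)
    (Finset.mem_insert_self _ _) (fun v hv => hS v fun h => hv (Finset.mem_insert_of_mem h)) hUp hUur hUinl hSp hSur hSinl y₀ hy₀ N hN e hb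
  have h59 : Nat.card 𝓢inf.selmerGroup = Nat.card (katoStrictSelmer W p {primePlace p}) :=
    natCard_selmerGroup_eq_natCard_katoStrictSelmer W p 𝓢inf hSp hSur hSinl
  rw [h59] at h58
  rw [hrel] at hdvd
  -- cancel `#Sel_str` against the index
  obtain ⟨t, ht⟩ := hdvd
  have hSel0 : Nat.card (katoStrictSelmer W p {primePlace p}) ≠ 0 := fun h0 ↦ hrel0 (by rw [ht, h0, zero_mul])
  have ht1 : 1 ≤ t := Nat.one_le_iff_ne_zero.mpr fun h0 ↦ hrel0 (by rw [ht, h0, mul_zero])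
  set cS := Nat.card (katoStrictSelmer W p {primePlace p}) with hcS
  set a := p ^ padicValNat p W.tamagawaProduct * Nat.card (AddCommGroup.primaryComponent (↥W.sha) p) with ha
  set b := p ^ padicValNat p ((W.baseChange ((primePlace p).adicCompletion ℚ)).localTamagawaNumber
      ((primePlace p).adicCompletionIntegers ℚ)) * p ^ e * (p ^ padicValNat p W.torsionOrder) ^ 2 with hb'
  have h1 : cS * (a * t) ≤ cS * b := by
    have : a * (cS * t) ≤ p ^ padicValNat p ((W.baseChange ((primePlace p).adicCompletion ℚ)).localTamagawaNumber
        ((primePlace p).adicCompletionIntegers ℚ)) * cS * p ^ e * (p ^ padicValNat p W.torsionOrder) ^ 2 := by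
      rw [← ht]; exact h58
    calc cS * (a * t) = a * (cS * t) := by ring
      _ ≤ _ := this
      _ = cS * b := by rw [hb']; ring
  have h2 : a * t ≤ b := Nat.le_of_mul_le_mul_left h1 (Nat.pos_of_ne_zero hSel0)
  have h3 : a ≤ b := le_trans (Nat.le_mul_of_pos_right a ht1) h2
  -- every factor is a power of `p`
  obtain ⟨s, hs⟩ := MemberHullZetaInputsOfCore.natCard_primaryComponent_eq_prime_pow p (G := ↥W.sha)
  have h4 : p ^ (padicValNat p W.tamagawaProduct + s) ≤
      p ^ (e + padicValNat p ((W.baseChange ((primePlace p).adicCompletion ℚ)).localTamagawaNumber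
          ((primePlace p).adicCompletionIntegers ℚ)) + 2 * padicValNat p W.torsionOrder) := by
    calc p ^ (padicValNat p W.tamagawaProduct + s) = a := by rw [ha, hs, pow_add]
      _ ≤ b := h3
      _ = _ := by rw [hb', ← pow_mul, ← pow_add, ← pow_add]; ring_nf
  have h5 := (Nat.pow_le_pow_iff_right hp.one_lt).mp h4
  rw [hs, padicValNat.prime_pow]
  omega

end Bound

/-! ## §3 The tame reducible non-CM rank-0 rows: the bound for Kato's zeta lift, modulo (b′) on it -/

section Rows

variable (W : WeierstrassCurve ℚ) [W.IsElliptic] (p : ℕ) [Fact p.Prime]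
  [ContinuousSMul ℤ_[p] (W.tateModule p)] [Module.Free ℤ_[p] (W.tateModule p)]
  [Module.Finite ℤ_[p] (W.tateModule p)]
  [Finite W.toAffine.Point] [Finite (AddCommGroup.primaryComponent W.sha p)]
  {κ : ZpExtension ℚ p} {γ : absoluteGaloisGroup ℚ}

/-- **CRUX M's INEQUALITY MODULO (b′) ON THE PINNED ZETA CLASS, on a reducible non-CM rank-0 row with `W(ℚ_p)[p] = 0`.**  For a
value-guarded `ZetaBody` family of the newform `f` of a curve `V` with `L(V,1) ≠ 0` and ITS Λ-adic lift `𝐲 ∈ 𝐇¹_Γ(T_pW)`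
(`∀ n, proj n 𝐲 = levelToLayer … (z (n+1) …)` — the binder under which the held package 27962 speaks of `𝐲`): for EVERY `e` with
`ZetaLineOrthIndexAt W p (layerZeroToTop 𝐲₀) e` ((b′) of 27962, there with `e = ord_p(L/Ω) + v_p(λ(0)) + t_p − v_p(c_p)`),
**`ord_p #Ш(W)[p^∞] + v_p(Tam W) ≤ e + v_p(c_p) + 2·v_p #W(ℚ)_tors`** — modulo {H2X, 13.4, Serre, FW, Lim 3.5} and nothing else
(Poitou–Tate over `ℚ`, the (14.14.1)-count and the exact fine control being kernel theorems).
[cite: Kato2004Asterisque, Thm. 12.5 (1) (p. 221), Thm. 14.5 (2)–(3) (p. 236), (14.9.3) (p. 240), §14.14 (pp. 243–244), Prop. 14.16 (2) (pp. 244–245), Lemma 14.18 (pp. 247–248)]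
[cite: MilneADT2006, Ch. I, Cor. 2.3, Thm. 4.10 (b)] [cite: GreenbergLNM1716, §3 Prop. 3.8, §4 Lemma 4.2] -/
theorem padicValNat_sha_add_tamagawa_le_of_zetaLineOrthIndexAt_zetaLift
    (hX : exists_iwasawaH2Data_fineSelmerDual_embedding)
    (h134 : thm13_4_lengthAt_fineSelmerDual_le_of_isEulerSystemClass)
    (hSerre : serre_adicImage_contains_congruenceSubgroup)
    (hLim : Lim2017.thm35_fineSelmerDual_moduleFinite_of_classicalMuVanishes_of_le_divisionField)
    (hFW : Literature.NumberTheory.IwasawaTheory.ferreroWashington1979_classicalMuVanishes)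
    (hp : p ≠ 2) (hκ : κ.IsCyclotomic) (hγ : κ.IsTopGenerator γ) (hCM : ¬ W.HasCM)
    (hred : ¬ W.HasIrreducibleModPGaloisRep p)
    (h4 : ∀ R : (W.baseChange ℚ_[p]).toAffine.Point, p • R = 0 → R = 0)
    (I : IwasawaH1Data W p κ γ) {N : ℕ} [NeZero N] {f : CuspForm (Gamma0 N) 2}
    {ι : (m : ℕ) → (CyclotomicField m ℚ →+* ℂ)} {κ' : ℝ}
    {Λ' : ∀ (k : ℕ) (r : Finset (HeightOneSpectrum (𝓞 ℚ))),
      H1 (tateRep W p) (cycSubgroup p k r) →ₗ[ℤ_[p]] ℚ_[p] ⊗[ℚ] CyclotomicField (cycLevel p k r) ℚ}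
    {c d a : ℤ} {A : ℕ}
    {z : ∀ (k : ℕ) (r : (cyclotomicLevelsRat p (badPlaces c d A N)).Ideals),
      H1 (tateRep W p) ((cyclotomicLevelsRat p (badPlaces c d A N)).level k r.1)}
    {x : ∀ (k : ℕ) (r : (cyclotomicLevelsRat p (badPlaces c d A N)).Ideals),
      CyclotomicField (cycLevel p k r.1) ℚ}
    (hbody : ZetaBody W p f ι κ' Λ' c d a A z x) (hne : 2 * c.natAbs * d.natAbs * A * N ≠ 0)
    {y : I.H} (hy : ∀ n : ℕ, I.proj n y = levelToLayer W p hκ hp (badPlaces c d A N) n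
      (z (n + 1) (cyclotomicLevelsRat p (badPlaces c d A N)).idealOne))
    {V : WeierstrassCurve ℚ} [V.IsElliptic] (hf : IsNewformOf V f) (hL1 : V.entireLFunction 1 ≠ 0)
    (hκ' : κ' ≠ 0) (hA : 0 < A) (d' : ℤ) (hcd : Int.gcd (c * d) A = 1) (hdd' : d * d' ≡ 1 [ZMOD (A : ℤ)])
    (hR : cuspFactor f true (fun _ ↦ 1) c d a A d' ≠ 0)
    (e : ℕ) (hb : ZetaLineOrthIndexAt W p (layerZeroToTop W p κ (I.proj 0 y)) e) :
    padicValNat p (Nat.card (AddCommGroup.primaryComponent W.sha p)) + padicValNat p W.tamagawaProduct ≤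
      e + padicValNat p ((W.baseChange ((primePlace p).adicCompletion ℚ)).localTamagawaNumber
          ((primePlace p).adicCompletionIntegers ℚ)) + 2 * padicValNat p W.torsionOrder := by
  obtain ⟨hfi, hdvd⟩ := ReducibleH2DescentCount.natCard_katoStrictSelmer_dvd_index_zetaLift_of_noPTorsionPadic W p hX h134 hSerre
    hLim hFW hp hκ hγ hCM hred h4 I hbody hne hy hf hL1 hκ' hA d' hcd hdd' hR
  exact padicValNat_sha_add_tamagawa_le_of_zetaLineOrthIndexAt_of_dvd W p hp I y hfi hdvd e hb

/-- **The `∃`-form over the six atomic facts {H2X, Z0, 13.4, Serre, FW, Lim 3.5}**: on a reducible non-CM rank-0 row with `L(W,1) ≠ 0` and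
`W(ℚ_p)[p] = 0` there is a non-zero genuine Euler-system class `𝐲 ∈ 𝐇¹_Γ(T_pW)` (Kato's `(c,d)`-zeta lift of the newform of `W`) with `𝐲₀`
of infinite order such that **for every `e` with `ZetaLineOrthIndexAt W p (layerZeroToTop 𝐲₀) e`:
`ord_p #Ш(W)[p^∞] + v_p(Tam W) ≤ e + v_p(c_p) + 2·v_p #W(ℚ)_tors`.**
[cite: Kato2004Asterisque, Thm. 12.5–12.6 (pp. 221–222), Thm. 14.5 (p. 236), Prop. 14.16 (2) (pp. 244–245), Lemma 14.18 (pp. 247–248)]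
[cite: MilneADT2006, Ch. I, Cor. 2.3, Thm. 4.10 (b)] -/
theorem exists_zetaLift_padicValNat_sha_add_tamagawa_le_of_zetaLineOrthIndexAt_of_noPTorsionPadic
    (hX : exists_iwasawaH2Data_fineSelmerDual_embedding)
    (hZ0 : exists_member_eulerSystem_expStar_values)
    (h134 : thm13_4_lengthAt_fineSelmerDual_le_of_isEulerSystemClass)
    (hSerre : serre_adicImage_contains_congruenceSubgroup)
    (hLim : Lim2017.thm35_fineSelmerDual_moduleFinite_of_classicalMuVanishes_of_le_divisionField)
    (hFW : Literature.NumberTheory.IwasawaTheory.ferreroWashington1979_classicalMuVanishes)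
    (hp : p ≠ 2) (hκ : κ.IsCyclotomic) (hγ : κ.IsTopGenerator γ) (hCM : ¬ W.HasCM)
    (hred : ¬ W.HasIrreducibleModPGaloisRep p)
    (h4 : ∀ R : (W.baseChange ℚ_[p]).toAffine.Point, p • R = 0 → R = 0)
    (I : IwasawaH1Data W p κ γ) {N : ℕ} [NeZero N] (f : CuspForm (Gamma0 N) 2) (hf : IsNewformOf W f)
    (hL1 : W.entireLFunction 1 ≠ 0) (ι : (m : ℕ) → (CyclotomicField m ℚ →+* ℂ)) :
    ∃ y : I.H, y ≠ 0 ∧ IsEulerSystemClass W p κ γ I y ∧ ¬ IsOfFinAddOrder (I.proj 0 y) ∧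
      ∀ e : ℕ, ZetaLineOrthIndexAt W p (layerZeroToTop W p κ (I.proj 0 y)) e →
        padicValNat p (Nat.card (AddCommGroup.primaryComponent W.sha p)) + padicValNat p W.tamagawaProduct ≤
          e + padicValNat p ((W.baseChange ((primePlace p).adicCompletion ℚ)).localTamagawaNumber
              ((primePlace p).adicCompletionIntegers ℚ)) + 2 * padicValNat p W.torsionOrder := by
  obtain ⟨y, hy0, hES, hnt, hfi, hdvd⟩ :=
    ReducibleH2DescentCount.exists_zetaLift_natCard_katoStrictSelmer_dvd_index_of_noPTorsionPadic W p hX hZ0 h134 hSerre hLim hFW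
      hp hκ hγ hCM hred h4 I f hf hL1 ι
  exact ⟨y, hy0, hES, hnt, fun e hb ↦ padicValNat_sha_add_tamagawa_le_of_zetaLineOrthIndexAt_of_dvd W p hp I y hfi hdvd e hb⟩

/-- **On every ADDITIVE row at `p ≥ 11`** (all (t′) rows of K8-t′; `W(ℚ_p)[p] = 0` is a tree theorem there).
[cite: Kato2004Asterisque, Thm. 14.5 (p. 236), Prop. 14.16 (2) (pp. 244–245), Lemma 14.18 (pp. 247–248)] [cite: Mazur1977, Ch. III §5, Step 1 (p. 158)] -/
theorem exists_zetaLift_padicValNat_sha_add_tamagawa_le_of_zetaLineOrthIndexAt_of_addv_of_eleven_le [W.IsGloballyMinimal]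
    (hX : exists_iwasawaH2Data_fineSelmerDual_embedding)
    (hZ0 : exists_member_eulerSystem_expStar_values)
    (h134 : thm13_4_lengthAt_fineSelmerDual_le_of_isEulerSystemClass)
    (hSerre : serre_adicImage_contains_congruenceSubgroup)
    (hLim : Lim2017.thm35_fineSelmerDual_moduleFinite_of_classicalMuVanishes_of_le_divisionField)
    (hFW : Literature.NumberTheory.IwasawaTheory.ferreroWashington1979_classicalMuVanishes)
    (h11 : 11 ≤ p) (hadd : Addv W p) (hκ : κ.IsCyclotomic) (hγ : κ.IsTopGenerator γ) (hCM : ¬ W.HasCM)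
    (hred : ¬ W.HasIrreducibleModPGaloisRep p)
    (I : IwasawaH1Data W p κ γ) {N : ℕ} [NeZero N] (f : CuspForm (Gamma0 N) 2) (hf : IsNewformOf W f)
    (hL1 : W.entireLFunction 1 ≠ 0) (ι : (m : ℕ) → (CyclotomicField m ℚ →+* ℂ)) :
    ∃ y : I.H, y ≠ 0 ∧ IsEulerSystemClass W p κ γ I y ∧ ¬ IsOfFinAddOrder (I.proj 0 y) ∧
      ∀ e : ℕ, ZetaLineOrthIndexAt W p (layerZeroToTop W p κ (I.proj 0 y)) e →
        padicValNat p (Nat.card (AddCommGroup.primaryComponent W.sha p)) + padicValNat p W.tamagawaProduct ≤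
          e + padicValNat p ((W.baseChange ((primePlace p).adicCompletion ℚ)).localTamagawaNumber
              ((primePlace p).adicCompletionIntegers ℚ)) + 2 * padicValNat p W.torsionOrder :=
  exists_zetaLift_padicValNat_sha_add_tamagawa_le_of_zetaLineOrthIndexAt_of_noPTorsionPadic W p hX hZ0 h134 hSerre hLim hFW (by omega)
    hκ hγ hCM hred (fun _ hR ↦ Additive.eq_zero_of_prime_nsmul_eq_zero_of_addv_of_eleven_le W p h11 hadd hR) I f hf hL1 ι

/-- **On an additive row at `p ≥ 5` off Kodaira II/III** (`p = 5 ⟹ v₅(c₄) ≠ 1`, `p = 7 ⟹ v₇(c₆) ≠ 1`).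
[cite: Kato2004Asterisque, Thm. 14.5 (p. 236), Prop. 14.16 (2) (pp. 244–245), Lemma 14.18 (pp. 247–248)] [cite: Mazur1977, Ch. III §5, Step 1 (p. 158)] -/
theorem exists_zetaLift_padicValNat_sha_add_tamagawa_le_of_zetaLineOrthIndexAt_of_addv [W.IsGloballyMinimal]
    (hX : exists_iwasawaH2Data_fineSelmerDual_embedding)
    (hZ0 : exists_member_eulerSystem_expStar_values)
    (h134 : thm13_4_lengthAt_fineSelmerDual_le_of_isEulerSystemClass)
    (hSerre : serre_adicImage_contains_congruenceSubgroup)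
    (hLim : Lim2017.thm35_fineSelmerDual_moduleFinite_of_classicalMuVanishes_of_le_divisionField)
    (hFW : Literature.NumberTheory.IwasawaTheory.ferreroWashington1979_classicalMuVanishes)
    (hp5 : 5 ≤ p) (hadd : Addv W p) (h5 : p = 5 → padicValRat p W.c₄ ≠ 1) (h7 : p = 7 → padicValRat p W.c₆ ≠ 1)
    (hκ : κ.IsCyclotomic) (hγ : κ.IsTopGenerator γ) (hCM : ¬ W.HasCM) (hred : ¬ W.HasIrreducibleModPGaloisRep p)
    (I : IwasawaH1Data W p κ γ) {N : ℕ} [NeZero N] (f : CuspForm (Gamma0 N) 2) (hf : IsNewformOf W f)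
    (hL1 : W.entireLFunction 1 ≠ 0) (ι : (m : ℕ) → (CyclotomicField m ℚ →+* ℂ)) :
    ∃ y : I.H, y ≠ 0 ∧ IsEulerSystemClass W p κ γ I y ∧ ¬ IsOfFinAddOrder (I.proj 0 y) ∧
      ∀ e : ℕ, ZetaLineOrthIndexAt W p (layerZeroToTop W p κ (I.proj 0 y)) e →
        padicValNat p (Nat.card (AddCommGroup.primaryComponent W.sha p)) + padicValNat p W.tamagawaProduct ≤
          e + padicValNat p ((W.baseChange ((primePlace p).adicCompletion ℚ)).localTamagawaNumber
              ((primePlace p).adicCompletionIntegers ℚ)) + 2 * padicValNat p W.torsionOrder :=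
  exists_zetaLift_padicValNat_sha_add_tamagawa_le_of_zetaLineOrthIndexAt_of_noPTorsionPadic W p hX hZ0 h134 hSerre hLim hFW (by omega)
    hκ hγ hCM hred (fun _ hR ↦ Additive.eq_zero_of_prime_nsmul_eq_zero_of_addv W p hp5 hadd h5 h7 hR) I f hf hL1 ι

end Rows

end Summit.BirchSwinnertonDyer.BirchSwinnertonDyer.Theorems.ReducibleTameShaBound

end
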